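import Mathlib
import Summits.Ventures.HodgeRepro.Tier4.Common.LocalCoordinatesConj
import Summits.Ventures.HodgeRepro.Tier4.Line4.D3CoeffDecay
import Summits.Ventures.HodgeRepro.Tier4.Line4.D3CoeffConj

/-!
# Tier4/Line4/D3CoeffDecayConj — C-L4-D3DECAY, part 2: the entry bound on the SEESAW plane and the cubic decay
`‖D3coeff' x · bump x‖ ≤ C · exp(−3 · archDist x)` of the weight-3 coefficient times a bump

Blind re-derivation cell `pub-hodge-repro`, Tier 4 (README §9–§10), seat t4-L1-p5 (prover, gen 4; cut C-L4-D3COEFF /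
C-L4-D3DECAY, lead (R-8) S14747, S14971; paper proofs/t4/L4/D3COEFF-t4-L1-p5.md §6).  Target tree path
`lean/Summits/Ventures/HodgeRepro/Tier4/Line4/D3CoeffDecayConj.lean`.  On part 1 (`D3CoeffDecay`: the row-plane bound
`sum_norm_adToC_mat_le`) and typer-2's `Common/LocalCoordinatesConj` (`conjTo`, `mat_conjTo`, `locEntry'`); no printed input.

THE STATEMENT (plan-4 g4's (7″) `IsArchCoeffD.decay`, written out — `archSizeAt W w x = ∑ᵢⱼ ‖adToC w (mat x i j)‖`,
`archDist W x = ∑_w log (max 1 (archSizeAt W w x))`, `HasDecay3 W f = ∃ C, ∀ x, ‖f x‖ ≤ C · exp (−3 · archDist W x)`):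
* `sum_norm_adToC_mul_le` — the entrywise `ℓ¹` size at `w` is sub-multiplicative, `‖A M‖₁ ≤ ‖A‖₁ ‖M‖₁`;
* `mat_eq_adMat_mul_mat_conjTo` — `mat x = adMat g · mat (g′ x g) · adMat g′` (`mat_conjTo` and `g g′ = 1`);
* **`sum_norm_adToC_mat_le'`** — on the seesaw plane, `archSizeAt W w x ≤ c_g · ‖locEntry' x 0 0‖` with
  `c_g = ‖adMat g‖₁ ‖adMat g′‖₁ · 16 · blockBound q w · C₁` (the row-plane bound transported through `conjTo`);
* `decay_of_bounds` — the real-variable core: if `m_w ≤ c · y`, `m_i ≤ M` for `i ≠ w`, `m_i ≥ 1`, `M ≥ 1`, then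
  `y⁻³ · b ≤ c³ · B · (M³)^n · exp (−3 ∑ᵢ log m_i)` for `0 ≤ b ≤ B`;
* **`hasDecay3_of_bump`** — for a bump `bump` with `‖bump‖ ≤ B` whose support has bounded size `≤ M` at every place
  `w′ ≠ w` (DISPLAYED hypotheses `hB`, `hsupp`): `∃ C, ∀ x, ‖D3coeff' x · bump x‖ ≤ C · exp (−(3 · ∑_{w′} log (max 1
  (∑ᵢⱼ ‖adToC w′ (mat x i j)‖))))` — `D3coeff' = (locEntry' x 0 0)⁻¹ ^ 3` decays like the cube of the size at `w`, and
  the bump confines the other places.  Without the bump factor there is NO decay in the directions of the places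
  `w′ ≠ w` (the coefficient is constant there): the bump is load-bearing.

Nothing here says anything about the status of the Hodge conjecture for CM abelian varieties, which is NOT proved
(HC_CM is NOT proved by anyone in this repository).
-/

set_option autoImplicit false

noncomputable section

namespace Summit.Ventures.HodgeRepro.Tier4.Line4

open Summit.Ventures.HodgeRepro.Tier4.Common NumberField Matrix

section Generic

variable {k : Type} [Field k] [NumberField k] (w : InfinitePlace k)

/-- **sub-multiplicativity of the entrywise `ℓ¹` size at `w`**: `∑ᵢⱼ ‖adToC w ((A M) i j)‖ ≤ (∑ᵢⱼ ‖adToC w (A i j)‖) ·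
(∑ᵢⱼ ‖adToC w (M i j)‖)`. -/
theorem sum_norm_adToC_mul_le (A M : Matrix (Fin 4) (Fin 4) (Ad k)) :
    ∑ i : Fin 4, ∑ j : Fin 4, ‖adToC w ((A * M) i j)‖ ≤
      (∑ i : Fin 4, ∑ j : Fin 4, ‖adToC w (A i j)‖) * (∑ i : Fin 4, ∑ j : Fin 4, ‖adToC w (M i j)‖) := by
  set SM := ∑ i : Fin 4, ∑ j : Fin 4, ‖adToC w (M i j)‖ with hSM
  have hrow : ∀ l : Fin 4, ∑ j : Fin 4, ‖adToC w (M l j)‖ ≤ SM := fun l =>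
    Finset.single_le_sum (f := fun l : Fin 4 => ∑ j : Fin 4, ‖adToC w (M l j)‖)
      (fun _ _ => Finset.sum_nonneg fun _ _ => norm_nonneg _) (Finset.mem_univ l)
  calc ∑ i : Fin 4, ∑ j : Fin 4, ‖adToC w ((A * M) i j)‖
      ≤ ∑ i : Fin 4, ∑ j : Fin 4, ∑ l : Fin 4, ‖adToC w (A i l)‖ * ‖adToC w (M l j)‖ := by
        refine Finset.sum_le_sum fun i _ => Finset.sum_le_sum fun j _ => ?_
        rw [Matrix.mul_apply, map_sum]
        refine (norm_sum_le _ _).trans (Finset.sum_le_sum fun l _ => ?_)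
        rw [map_mul]
        exact norm_mul_le _ _
    _ = ∑ i : Fin 4, ∑ l : Fin 4, ‖adToC w (A i l)‖ * ∑ j : Fin 4, ‖adToC w (M l j)‖ := by
        refine Finset.sum_congr rfl fun i _ => ?_
        rw [Finset.sum_comm]
        refine Finset.sum_congr rfl fun l _ => ?_
        rw [Finset.mul_sum]
    _ ≤ ∑ i : Fin 4, ∑ l : Fin 4, ‖adToC w (A i l)‖ * SM := by
        refine Finset.sum_le_sum fun i _ => Finset.sum_le_sum fun l _ => ?_
        exact mul_le_mul_of_nonneg_left (hrow l) (norm_nonneg _)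
    _ = (∑ i : Fin 4, ∑ j : Fin 4, ‖adToC w (A i j)‖) * SM := by
        rw [Finset.sum_mul]
        refine Finset.sum_congr rfl fun i _ => ?_
        rw [Finset.sum_mul]

/-- **the real-variable core of the decay**: with `m_i ≥ 1`, `m_w ≤ c · y`, `m_i ≤ M` for `i ≠ w`, `M ≥ 1`, `y > 0`,
`0 ≤ b ≤ B`: `y⁻¹ ^ 3 · b ≤ c ^ 3 · B · (M ^ 3) ^ n · exp (−(3 · ∑ᵢ log m_i))` (`n = card ι`). -/
theorem decay_of_bounds {ι : Type*} [Fintype ι] [DecidableEq ι] (w : ι) (m : ι → ℝ) (hm : ∀ i, 1 ≤ m i)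
    (M : ℝ) (hM : 1 ≤ M) (hoth : ∀ i, i ≠ w → m i ≤ M) (c : ℝ) (hc : 0 ≤ c) (y : ℝ) (hy0 : 0 < y)
    (hy : m w ≤ c * y) (B b : ℝ) (hb0 : 0 ≤ b) (hb : b ≤ B) :
    y⁻¹ ^ 3 * b ≤ c ^ 3 * B * (M ^ 3) ^ Fintype.card ι * Real.exp (-(3 * ∑ i, Real.log (m i))) := by
  have hmpos : ∀ i, 0 < m i := fun i => lt_of_lt_of_le one_pos (hm i)
  have hM3 : 1 ≤ M ^ 3 := one_le_pow₀ hM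
  have hM3pos : 0 < M ^ 3 := lt_of_lt_of_le one_pos hM3
  -- `exp (−3 ∑ log m_i) = ∏ (m_i ^ 3)⁻¹`
  have hexp : Real.exp (-(3 * ∑ i, Real.log (m i))) = ∏ i, (m i ^ 3)⁻¹ := by
    rw [Finset.mul_sum, ← Finset.sum_neg_distrib, Real.exp_sum]
    refine Finset.prod_congr rfl fun i _ => ?_
    rw [Real.exp_neg, show (3 : ℝ) * Real.log (m i) = ((3 : ℕ) : ℝ) * Real.log (m i) by norm_num,
      Real.exp_nat_mul, Real.exp_log (hmpos i)]
  rw [hexp]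
  -- the product is at least `(m_w ^ 3)⁻¹ · ((M ^ 3)⁻¹) ^ n`
  have hprod : (m w ^ 3)⁻¹ * ((M ^ 3)⁻¹) ^ Fintype.card ι ≤ ∏ i, (m i ^ 3)⁻¹ := by
    rw [← Finset.mul_prod_erase Finset.univ (fun i => (m i ^ 3)⁻¹) (Finset.mem_univ w)]
    refine mul_le_mul_of_nonneg_left ?_ (inv_nonneg.2 (pow_nonneg (hmpos w).le 3))
    calc ((M ^ 3)⁻¹) ^ Fintype.card ι ≤ ((M ^ 3)⁻¹) ^ (Finset.univ.erase w).card :=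
          pow_le_pow_of_le_one (inv_nonneg.2 hM3pos.le) (inv_le_one_of_one_le₀ hM3)
            (Finset.card_le_univ _)
      _ = ∏ _i ∈ Finset.univ.erase w, (M ^ 3)⁻¹ := (Finset.prod_const _).symm
      _ ≤ ∏ i ∈ Finset.univ.erase w, (m i ^ 3)⁻¹ := by
          refine Finset.prod_le_prod (fun i _ => inv_nonneg.2 hM3pos.le) fun i hi => ?_
          have hi' : i ≠ w := Finset.ne_of_mem_erase hi
          exact inv_anti₀ (pow_pos (hmpos i) 3) (pow_le_pow_left₀ (hmpos i).le (hoth i hi') 3)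
  -- `y⁻¹ ^ 3 ≤ c ^ 3 · (m_w ^ 3)⁻¹`
  have hy3 : y⁻¹ ^ 3 ≤ c ^ 3 * (m w ^ 3)⁻¹ := by
    rw [inv_pow, inv_eq_one_div, div_le_iff₀ (pow_pos hy0 3)]
    have hmw : m w ^ 3 ≤ (c * y) ^ 3 := pow_le_pow_left₀ (hmpos w).le hy 3
    rw [mul_pow] at hmw
    have : c ^ 3 * (m w ^ 3)⁻¹ * y ^ 3 = (c ^ 3 * y ^ 3) / m w ^ 3 := by ring
    rw [this, le_div_iff₀ (pow_pos (hmpos w) 3), one_mul]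
    exact hmw
  have hB0 : 0 ≤ B := hb0.trans hb
  have hc3 : 0 ≤ c ^ 3 := pow_nonneg hc 3
  have hmw3 : 0 ≤ (m w ^ 3)⁻¹ := inv_nonneg.2 (pow_nonneg (hmpos w).le 3)
  have hcancel : (M ^ 3) ^ Fintype.card ι * ((M ^ 3)⁻¹) ^ Fintype.card ι = 1 := by
    rw [← mul_pow, mul_inv_cancel₀ hM3pos.ne', one_pow]
  calc y⁻¹ ^ 3 * b ≤ (c ^ 3 * (m w ^ 3)⁻¹) * B :=
        mul_le_mul hy3 hb hb0 (mul_nonneg hc3 hmw3)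
    _ = c ^ 3 * B * (M ^ 3) ^ Fintype.card ι * ((m w ^ 3)⁻¹ * ((M ^ 3)⁻¹) ^ Fintype.card ι) := by
        have : c ^ 3 * B * (M ^ 3) ^ Fintype.card ι * ((m w ^ 3)⁻¹ * ((M ^ 3)⁻¹) ^ Fintype.card ι) =
            c ^ 3 * (m w ^ 3)⁻¹ * B * ((M ^ 3) ^ Fintype.card ι * ((M ^ 3)⁻¹) ^ Fintype.card ι) := by ring
        rw [this, hcancel, mul_one]
    _ ≤ c ^ 3 * B * (M ^ 3) ^ Fintype.card ι * ∏ i, (m i ^ 3)⁻¹ :=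
        mul_le_mul_of_nonneg_left hprod
          (mul_nonneg (mul_nonneg hc3 hB0) (pow_nonneg hM3pos.le _))

end Generic

section Seesaw

variable {k : Type} [Field k] [NumberField k] (q : QuadData k) (a : Fin 4 → k)
  (g g' : Matrix (Fin 4) (Fin 4) k) (hgg' : g * g' = 1) (hg'g : g' * g = 1)
  (hgΩ : g * (PlaneData.mixedRow q (a 0) (a 2)).Ω = (PlaneData.mixedRow q (a 0) (a 2)).Ω * g)
  (lam : k) (hlam : lam ≠ 0)
  (hiso : g * (PlaneData.mixedRow q (a 1) (a 3)).B * gᵀ = lam • (PlaneData.mixedRow q (a 0) (a 2)).B)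
  (w : InfinitePlace k)

/-- **`mat x = adMat g · mat (g′ x g) · adMat g′`** — `mat_conjTo` read backwards with `g g′ = 1`. -/
theorem mat_eq_adMat_mul_mat_conjTo
    (x : GA ((PlaneData.mixedRow q (a 0) (a 2)).withTransportedTorus g g' hgg' hg'g hgΩ)) :
    GA.mat ((PlaneData.mixedRow q (a 0) (a 2)).withTransportedTorus g g' hgg' hg'g hgΩ) x =
      adMat k g * GA.mat (PlaneData.ofLinesRow q (a 1) (a 3) (-1)) (conjTo q a g g' hgg' hg'g hgΩ lam hiso x) *
        adMat k g' := by
  rw [mat_conjTo]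
  have hA : adMat k g * adMat k g' = 1 := adMat_mul_adMat_eq_one g g' hgg'
  set M := GA.mat ((PlaneData.mixedRow q (a 0) (a 2)).withTransportedTorus g g' hgg' hg'g hgΩ) x with hM
  calc M = (adMat k g * adMat k g') * M * (adMat k g * adMat k g') := by rw [hA, one_mul, mul_one]
    _ = adMat k g * (adMat k g' * M * adMat k g) * adMat k g' := by simp only [Matrix.mul_assoc]

include hlam in
/-- **THE ENTRY BOUND ON THE SEESAW PLANE**: `∑ᵢⱼ ‖adToC w (mat x i j)‖ ≤ c_g · ‖locEntry' x 0 0‖` with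
`c_g = ‖adMat g‖₁ · ‖adMat g′‖₁ · 16 · blockBound q w · C₁` — the row-plane bound of part 1 at `g′ x g`, transported
by the sub-multiplicativity of the `ℓ¹` size. -/
theorem sum_norm_adToC_mat_le' (hw : w.IsReal) (hcm : IsCMAt q w)
    (ha1 : 0 < (adToC w (algebraMap k (Ad k) (a 1))).re) (ha3 : (adToC w (algebraMap k (Ad k) (-1 * a 3))).re < 0)
    (x : GA ((PlaneData.mixedRow q (a 0) (a 2)).withTransportedTorus g g' hgg' hg'g hgΩ)) :
    ∑ i : Fin 4, ∑ j : Fin 4,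
        ‖adToC w (GA.mat ((PlaneData.mixedRow q (a 0) (a 2)).withTransportedTorus g g' hgg' hg'g hgΩ) x i j)‖ ≤
      (∑ i : Fin 4, ∑ j : Fin 4, ‖adToC w (adMat k g i j)‖) * (∑ i : Fin 4, ∑ j : Fin 4, ‖adToC w (adMat k g' i j)‖) *
        (16 * blockBound q w *
          (1 + Real.sqrt ((adToC w (algebraMap k (Ad k) (a 1))).re / (-(adToC w (algebraMap k (Ad k) (-1 * a 3))).re)) +
            Real.sqrt ((-(adToC w (algebraMap k (Ad k) (-1 * a 3))).re) / (adToC w (algebraMap k (Ad k) (a 1))).re))) *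
        ‖locEntry' q a g g' hgg' hg'g hgΩ lam hiso w x 0 0‖ := by
  have _hlam := hlam
  rw [mat_eq_adMat_mul_mat_conjTo q a g g' hgg' hg'g hgΩ lam hiso x]
  set N := GA.mat (PlaneData.ofLinesRow q (a 1) (a 3) (-1)) (conjTo q a g g' hgg' hg'g hgΩ lam hiso x) with hN
  set Sg := ∑ i : Fin 4, ∑ j : Fin 4, ‖adToC w (adMat k g i j)‖ with hSg
  set Sg' := ∑ i : Fin 4, ∑ j : Fin 4, ‖adToC w (adMat k g' i j)‖ with hSg'
  set K := 16 * blockBound q w *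
    (1 + Real.sqrt ((adToC w (algebraMap k (Ad k) (a 1))).re / (-(adToC w (algebraMap k (Ad k) (-1 * a 3))).re)) +
      Real.sqrt ((-(adToC w (algebraMap k (Ad k) (-1 * a 3))).re) / (adToC w (algebraMap k (Ad k) (a 1))).re)) with hK
  have hSg0 : 0 ≤ Sg := Finset.sum_nonneg fun _ _ => Finset.sum_nonneg fun _ _ => norm_nonneg _
  have hSg'0 : 0 ≤ Sg' := Finset.sum_nonneg fun _ _ => Finset.sum_nonneg fun _ _ => norm_nonneg _
  have hrow : ∑ i : Fin 4, ∑ j : Fin 4, ‖adToC w (N i j)‖ ≤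
      K * ‖locEntry' q a g g' hgg' hg'g hgΩ lam hiso w x 0 0‖ := by
    have h := sum_norm_adToC_mat_le q (a 1) (a 3) (-1) w hw hcm ha1 ha3 (conjTo q a g g' hgg' hg'g hgΩ lam hiso x)
    have hl : locEntry' q a g g' hgg' hg'g hgΩ lam hiso w x 0 0 =
        locEntry q (a 1) (a 3) (-1) w (conjTo q a g g' hgg' hg'g hgΩ lam hiso x) 0 0 := rfl
    rw [hK, hl]
    simpa only [mul_assoc] using h
  calc ∑ i : Fin 4, ∑ j : Fin 4, ‖adToC w ((adMat k g * N * adMat k g') i j)‖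
      ≤ (∑ i : Fin 4, ∑ j : Fin 4, ‖adToC w ((adMat k g * N) i j)‖) * Sg' := sum_norm_adToC_mul_le w _ _
    _ ≤ (Sg * ∑ i : Fin 4, ∑ j : Fin 4, ‖adToC w (N i j)‖) * Sg' :=
        mul_le_mul_of_nonneg_right (sum_norm_adToC_mul_le w _ _) hSg'0
    _ ≤ (Sg * (K * ‖locEntry' q a g g' hgg' hg'g hgΩ lam hiso w x 0 0‖)) * Sg' :=
        mul_le_mul_of_nonneg_right (mul_le_mul_of_nonneg_left hrow hSg0) hSg'0
    _ = Sg * Sg' * K * ‖locEntry' q a g g' hgg' hg'g hgΩ lam hiso w x 0 0‖ := by ring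

include hlam in
/-- **THE CUBIC DECAY** (plan-4's `HasDecay3`, written out): for a bump `bump` with `‖bump‖ ≤ B` whose support has
size `≤ M` at every place `w′ ≠ w` (DISPLAYED: `hB`, `hsupp`, `1 ≤ M`), `∃ C, ∀ x, ‖D3coeff' x · bump x‖ ≤
C · exp (−(3 · ∑_{w′} log (max 1 (∑ᵢⱼ ‖adToC w′ (mat x i j)‖))))` — `‖D3coeff' x‖ = ‖locEntry' x 0 0‖⁻¹ ^ 3` and the
size at `w` is `≤ c_g ‖locEntry' x 0 0‖` (`sum_norm_adToC_mat_le'`); `C = (max 1 c_g) ^ 3 · B · (M ^ 3) ^ n`. -/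
theorem hasDecay3_of_bump (hw : w.IsReal) (hcm : IsCMAt q w)
    (ha1 : 0 < (adToC w (algebraMap k (Ad k) (a 1))).re) (ha3 : (adToC w (algebraMap k (Ad k) (-1 * a 3))).re < 0)
    (bump : GA ((PlaneData.mixedRow q (a 0) (a 2)).withTransportedTorus g g' hgg' hg'g hgΩ) → ℂ) (B M : ℝ)
    (hM : 1 ≤ M) (hB : ∀ x, ‖bump x‖ ≤ B)
    (hsupp : ∀ x, bump x ≠ 0 → ∀ w' : InfinitePlace k, w' ≠ w →
      ∑ i : Fin 4, ∑ j : Fin 4,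
        ‖adToC w' (GA.mat ((PlaneData.mixedRow q (a 0) (a 2)).withTransportedTorus g g' hgg' hg'g hgΩ) x i j)‖ ≤ M) :
    ∃ C : ℝ, ∀ x : GA ((PlaneData.mixedRow q (a 0) (a 2)).withTransportedTorus g g' hgg' hg'g hgΩ),
      ‖D3coeff' q a g g' hgg' hg'g hgΩ lam hiso w x * bump x‖ ≤
        C * Real.exp (-(3 * ∑ w' : InfinitePlace k, Real.log (max 1 (∑ i : Fin 4, ∑ j : Fin 4,
          ‖adToC w' (GA.mat ((PlaneData.mixedRow q (a 0) (a 2)).withTransportedTorus g g' hgg' hg'g hgΩ) x i j)‖)))) := by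
  classical
  set cg := (∑ i : Fin 4, ∑ j : Fin 4, ‖adToC w (adMat k g i j)‖) *
      (∑ i : Fin 4, ∑ j : Fin 4, ‖adToC w (adMat k g' i j)‖) *
        (16 * blockBound q w *
          (1 + Real.sqrt ((adToC w (algebraMap k (Ad k) (a 1))).re / (-(adToC w (algebraMap k (Ad k) (-1 * a 3))).re)) +
            Real.sqrt ((-(adToC w (algebraMap k (Ad k) (-1 * a 3))).re) / (adToC w (algebraMap k (Ad k) (a 1))).re)))
    with hcg
  set c := max 1 cg with hc
  have hc1 : 1 ≤ c := le_max_left _ _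
  have hc0 : 0 ≤ c := zero_le_one.trans hc1
  have hB0 : 0 ≤ B := (norm_nonneg _).trans (hB 1)
  have hM3pos : 0 < M ^ 3 := pow_pos (lt_of_lt_of_le one_pos hM) 3
  refine ⟨c ^ 3 * B * (M ^ 3) ^ Fintype.card (InfinitePlace k), fun x => ?_⟩
  set size : InfinitePlace k → ℝ := fun w' => ∑ i : Fin 4, ∑ j : Fin 4,
    ‖adToC w' (GA.mat ((PlaneData.mixedRow q (a 0) (a 2)).withTransportedTorus g g' hgg' hg'g hgΩ) x i j)‖ with hsize
  set α := locEntry' q a g g' hgg' hg'g hgΩ lam hiso w x 0 0 with hα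
  have hα1 : 1 ≤ ‖α‖ :=
    one_le_norm_locEntry_zero_zero q (a 1) (a 3) (-1) w hw hcm (disc_ne_zero_of_isCMAt q w hw hcm) ha1 ha3 _
  have hα0 : 0 < ‖α‖ := lt_of_lt_of_le one_pos hα1
  have hD3 : ‖D3coeff' q a g g' hgg' hg'g hgΩ lam hiso w x‖ = ‖α‖⁻¹ ^ 3 := by
    rw [D3coeff'_eq, norm_pow, norm_inv]
  by_cases hbx : bump x = 0
  · rw [hbx, mul_zero, norm_zero]
    exact mul_nonneg (mul_nonneg (mul_nonneg (pow_nonneg hc0 3) hB0) (pow_nonneg hM3pos.le _))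
      (Real.exp_pos _).le
  · have hsw : size w ≤ c * ‖α‖ := by
      calc size w ≤ cg * ‖α‖ := sum_norm_adToC_mat_le' q a g g' hgg' hg'g hgΩ lam hlam hiso w hw hcm ha1 ha3 x
        _ ≤ c * ‖α‖ := mul_le_mul_of_nonneg_right (le_max_right _ _) hα0.le
    have hmw : max 1 (size w) ≤ c * ‖α‖ :=
      max_le (by nlinarith) hsw
    have hoth : ∀ w' : InfinitePlace k, w' ≠ w → max 1 (size w') ≤ M := fun w' hw' =>
      max_le hM (hsupp x hbx w' hw')
    rw [norm_mul, hD3]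
    exact decay_of_bounds w (fun w' => max 1 (size w')) (fun _ => le_max_left _ _) M hM hoth c hc0 ‖α‖ hα0 hmw B
      ‖bump x‖ (norm_nonneg _) (hB x)

end Seesaw

end Summit.Ventures.HodgeRepro.Tier4.Line4

end
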